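import Summits.Ventures.LatticeQCDFlow.Exactness.FreeFieldHeatBathExact
import HarnessLib

/-!
# The single-site Metropolis hit is exact for lattice φ⁴ on `ℝ^Λ` — every `λ > 0`, every `m²`

HONEST FRAMING: exact (Metropolis-corrected) sampling algorithms for lattice gauge theory;
figures of merit are autocorrelation/cost numbers at stated couplings and volumes; no
continuum-physics claim.  (SCALAR calibration rung S0-A: not a gauge result.)

Venture `LatticeQCDFlow` (cell pub-lqcd), topic `Exactness`; FANOUT row 2 (`s0-phi4`: the LOCAL
METROPOLIS comparator of the 2D φ⁴ calibration and the battery's detailed-balance leg T2).  NEW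
WORK of the cell (Fubini on `ℝ × ℝ` and on `ℝ^{n+1}`, over Mathlib); nothing is cited as a fact.
Printed counterparts, named only: Metropolis–Rosenbluth–Rosenbluth–Teller–Teller 1953, Hastings
1970, Tierney 1998 §2 (reversibility of Metropolis–Hastings kernels on general spaces).

Relation to the tree.  Row 9's `Exactness/SymmetricMetropolis.lean` / `LocalMetropolis.lean` /
`FibreLift.lean` prove reversibility ABSTRACTLY over Mathlib `Kernel`s (instanced for random walks
on a group).  This file is the CONCRETE statement for the sampler row 2 ran: single-site
random-walk Metropolis of INTERACTING lattice φ⁴ (`latticePhi4Action`, the engine's `phi4_2d`) on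
`Fin (n+1) → ℝ` with Lebesgue measure and an additive increment of even density `ρ`, in the
integrated form `∫ (M_x f) e^{−S} = ∫ f e^{−S}`, every measurability / integrability obligation
discharged by the coercivity of the quartic action.

## What is proved

* §1 (the line).  `metroFlow w ρ t t' = min(w t, w t') ρ(t' − t)` (symmetric for even `ρ`);
  `accept_mul_weight` — detailed balance in density form;
  **`metropolis_line_invariant`** — for a positive integrable weight `w`, an even probability
  density `ρ` and every bounded measurable `g`: `∫ (K g) w = ∫ g w`,
  `(K g)(t) = ∫ [α g(t') + (1−α) g(t)] ρ(t'−t) dt'`, `α = min(1, w t'/w t)` (the rejected mass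
  stays put; the two flow terms cancel by Fubini + symmetry, dominated by `w(t)ρ(t'−t)`).
* §2 (the lattice).  `metroAccept` (`= min(1, e^{−ΔS})`, `metroAccept_eq_exp`), `metroSite` —
  the one-site Metropolis operator on observables; `abs_metroSite_le`, `measurable_metroSite`,
  `integrable_gibbsWeight_line` (the weight along a coordinate line is the one-site quartic weight
  of `Scoring/SchwingerDysonPhi4.lean`, integrable under coercivity);
  **`metropolis_site_exact`** — `S` coercive (`εΣφ² − K ≤ S`), `ρ ≥ 0` measurable even with
  `∫ρ = 1`, `f` bounded measurable: `∫ (M_x f) e^{−S} dφ = ∫ f e^{−S} dφ` for every site `x`;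
  `metropolis_site_exact_expect` (`⟨M_x f⟩ = ⟨f⟩`); **`metropolis_site_exact_phi4`** — EVERY
  `λ > 0`, EVERY real `J` (`latticePhi4Action_coercive`; in particular the tachyonic AKS 2019 sets
  `m² = −4`, `λ ∈ {…}`): the Gibbs law `e^{−S}dφ/Z` of interacting lattice φ⁴ is invariant under
  the Metropolis hit at any site with any symmetric step law (uniform window, Gaussian, …) — the
  step only moves the acceptance.

A sweep (composition / average of such hits) then fixes the law too — the exactness half of the
battery's T2 leg for row 2's local sampler, at every volume.  NOT CLAIMED: irreducibility,
autocorrelations of the Metropolis chain (no closed form even at `λ = 0`), optimal step size.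
-/

namespace Summit.Ventures.LatticeQCDFlow.Exactness

open Real MeasureTheory Finset Filter
open Summit.Ventures.LatticeQCDFlow.Scoring

/-! ## The one-dimensional fact: Metropolis with a symmetric proposal preserves `w(t) dt` -/

section Line
/-- The symmetrised flow density `s(t, t') = min(w t, w t') ρ(t' − t)`. -/
noncomputable def metroFlow (w ρ : ℝ → ℝ) (t t' : ℝ) : ℝ := min (w t) (w t') * ρ (t' - t)

/-- `s` is symmetric when `ρ` is even. -/
theorem metroFlow_symm (w ρ : ℝ → ℝ) (hρs : ∀ u, ρ (-u) = ρ u) (t t' : ℝ) :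
    metroFlow w ρ t t' = metroFlow w ρ t' t := by
  unfold metroFlow; rw [min_comm, show t' - t = -(t - t') by ring, hρs]

/-- Detailed balance in density form: `min(1, w t'/w t) · ρ(t'−t) · w t = s(t, t')` (`w t > 0`). -/
theorem accept_mul_weight (w ρ : ℝ → ℝ) {t : ℝ} (hw : 0 < w t) (t' : ℝ) :
    min 1 (w t' / w t) * ρ (t' - t) * w t = metroFlow w ρ t t' := by
  unfold metroFlow
  rw [mul_right_comm, min_mul_of_nonneg _ _ hw.le, one_mul, div_mul_cancel₀ _ hw.ne']

/-- The dominating function `(t, t') ↦ w t · ρ(t' − t)` is integrable on the plane, with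
iterated integral `∫ w`. -/
theorem integrable_weight_mul_proposal {w ρ : ℝ → ℝ} (hwm : Measurable w) (hwi : Integrable w)
    (hw0 : ∀ t, 0 ≤ w t) (hρm : Measurable ρ) (hρi : Integrable ρ) (hρ0 : ∀ u, 0 ≤ ρ u)
    (hρ1 : ∫ u, ρ u = 1) :
    Integrable (fun p : ℝ × ℝ => w p.1 * ρ (p.2 - p.1)) ((volume : Measure ℝ).prod volume) := by
  have hm : Measurable fun p : ℝ × ℝ => w p.1 * ρ (p.2 - p.1) :=
    (hwm.comp measurable_fst).mul (hρm.comp (measurable_snd.sub measurable_fst))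
  rw [integrable_prod_iff hm.aestronglyMeasurable]
  constructor
  · refine Eventually.of_forall fun t => ?_
    exact (hρi.comp_sub_right t).const_mul (w t)
  · have e : (fun t => ∫ t', ‖w t * ρ (t' - t)‖) = fun t => w t := by
      funext t
      have h1 : ∀ t', ‖w t * ρ (t' - t)‖ = w t * ρ (t' - t) := fun t' => by
        rw [Real.norm_eq_abs, abs_of_nonneg (mul_nonneg (hw0 t) (hρ0 _))]
      simp only [h1]
      rw [integral_const_mul, integral_sub_right_eq_self (μ := (volume : Measure ℝ)) ρ t, hρ1,
        mul_one]
    rw [e]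
    exact hwi

/-- **Metropolis on the line preserves `w`.**  For a positive integrable weight `w`, an even
probability density `ρ` (the proposal increment) and every bounded measurable test function `g`:
`∫ (K g)(t) w(t) dt = ∫ g w`, where
`(K g)(t) = ∫ [min(1, w t'/w t) g(t') + (1 − min(1, w t'/w t)) g(t)] ρ(t' − t) dt'`. -/
theorem metropolis_line_invariant {w ρ g : ℝ → ℝ} (hw0 : ∀ t, 0 < w t) (hwm : Measurable w)
    (hwi : Integrable w) (hρ0 : ∀ u, 0 ≤ ρ u) (hρm : Measurable ρ) (hρi : Integrable ρ)
    (hρ1 : ∫ u, ρ u = 1) (hρs : ∀ u, ρ (-u) = ρ u) (hgm : Measurable g) {B : ℝ}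
    (hgb : ∀ t, |g t| ≤ B) :
    ∫ t, (∫ t', (min 1 (w t' / w t) * g t' + (1 - min 1 (w t' / w t)) * g t) * ρ (t' - t)) * w t
      = ∫ t, g t * w t := by
  have ha_le : ∀ t t', min (1 : ℝ) (w t' / w t) ≤ 1 := fun t t' => min_le_left _ _
  have ha_nn : ∀ t t', 0 ≤ min (1 : ℝ) (w t' / w t) :=
    fun t t' => le_min zero_le_one (div_nonneg (hw0 t').le (hw0 t).le)
  have hG := integrable_weight_mul_proposal hwm hwi (fun t => (hw0 t).le) hρm hρi hρ0 hρ1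
  have hsm : Measurable fun p : ℝ × ℝ => metroFlow w ρ p.1 p.2 := by
    unfold metroFlow
    exact ((hwm.comp measurable_fst).min (hwm.comp measurable_snd)).mul
      (hρm.comp (measurable_snd.sub measurable_fst))
  have hs_le : ∀ t t', |metroFlow w ρ t t'| ≤ w t * ρ (t' - t) := by
    intro t t'
    unfold metroFlow
    rw [abs_of_nonneg (mul_nonneg (le_min (hw0 t).le (hw0 t').le) (hρ0 _))]
    exact mul_le_mul_of_nonneg_right (min_le_left _ _) (hρ0 _)
  have hF1 : Integrable (fun p : ℝ × ℝ => metroFlow w ρ p.1 p.2 * g p.2)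
      ((volume : Measure ℝ).prod volume) := by
    refine Integrable.mono' (hG.const_mul B)
      (hsm.mul (hgm.comp measurable_snd)).aestronglyMeasurable (Eventually.of_forall fun p => ?_)
    rw [Real.norm_eq_abs, abs_mul]
    calc |metroFlow w ρ p.1 p.2| * |g p.2| ≤ (w p.1 * ρ (p.2 - p.1)) * B :=
          mul_le_mul (hs_le _ _) (hgb _) (abs_nonneg _) (mul_nonneg (hw0 _).le (hρ0 _))
      _ = B * (w p.1 * ρ (p.2 - p.1)) := by ring
  have hF2 : Integrable (fun p : ℝ × ℝ => metroFlow w ρ p.1 p.2 * g p.1)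
      ((volume : Measure ℝ).prod volume) := by
    refine Integrable.mono' (hG.const_mul B)
      (hsm.mul (hgm.comp measurable_fst)).aestronglyMeasurable (Eventually.of_forall fun p => ?_)
    rw [Real.norm_eq_abs, abs_mul]
    calc |metroFlow w ρ p.1 p.2| * |g p.1| ≤ (w p.1 * ρ (p.2 - p.1)) * B :=
          mul_le_mul (hs_le _ _) (hgb _) (abs_nonneg _) (mul_nonneg (hw0 _).le (hρ0 _))
      _ = B * (w p.1 * ρ (p.2 - p.1)) := by ring
  -- pointwise in `t`: `(K g)(t) · w(t) = ∫ s(t,·) g + g t w t − ∫ s(t,·) g t`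
  have hline : ∀ t,
      (∫ t', (min 1 (w t' / w t) * g t' + (1 - min 1 (w t' / w t)) * g t) * ρ (t' - t)) * w t
        = (∫ t', metroFlow w ρ t t' * g t') + g t * w t - ∫ t', metroFlow w ρ t t' * g t := by
    intro t
    have hρt : Integrable (fun t' => ρ (t' - t)) := hρi.comp_sub_right t
    have hI1 : Integrable (fun t' => min 1 (w t' / w t) * g t' * ρ (t' - t)) := by
      refine Integrable.mono' (hρt.const_mul B)
        ((((measurable_const.min (hwm.div_const (w t))).mul hgm).mul
          (hρm.comp (measurable_id.sub_const t))).aestronglyMeasurable)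
        (Eventually.of_forall fun t' => ?_)
      rw [Real.norm_eq_abs, abs_mul, abs_mul, abs_of_nonneg (ha_nn t t'), abs_of_nonneg (hρ0 _)]
      calc min 1 (w t' / w t) * |g t'| * ρ (t' - t) ≤ 1 * B * ρ (t' - t) := by
            gcongr
            · exact hρ0 _
            · exact ha_le t t'
            · exact hgb t'
        _ = B * ρ (t' - t) := by ring
    have hI2 : Integrable (fun t' => (1 - min 1 (w t' / w t)) * g t * ρ (t' - t)) := by
      refine Integrable.mono' (hρt.const_mul B)
        ((((measurable_const.sub (measurable_const.min (hwm.div_const (w t)))).mul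
          measurable_const).mul (hρm.comp (measurable_id.sub_const t))).aestronglyMeasurable)
        (Eventually.of_forall fun t' => ?_)
      have h1 : 0 ≤ 1 - min 1 (w t' / w t) := by linarith [ha_le t t']
      have h2 : 1 - min 1 (w t' / w t) ≤ 1 := by linarith [ha_nn t t']
      rw [Real.norm_eq_abs, abs_mul, abs_mul, abs_of_nonneg h1, abs_of_nonneg (hρ0 _)]
      calc (1 - min 1 (w t' / w t)) * |g t| * ρ (t' - t) ≤ 1 * B * ρ (t' - t) := by
            gcongr
            · exact hρ0 _
            · exact hgb t
        _ = B * ρ (t' - t) := by ring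
    have hsplit : ∀ t', (min 1 (w t' / w t) * g t' + (1 - min 1 (w t' / w t)) * g t) * ρ (t' - t)
        = min 1 (w t' / w t) * g t' * ρ (t' - t) + (1 - min 1 (w t' / w t)) * g t * ρ (t' - t) :=
      fun t' => by ring
    simp only [hsplit]
    rw [integral_add hI1 hI2, add_mul]
    -- first piece: `w t ∫ a g' ρ = ∫ s g'`
    have e1 : (∫ t', min 1 (w t' / w t) * g t' * ρ (t' - t)) * w t
        = ∫ t', metroFlow w ρ t t' * g t' := by
      rw [← integral_mul_const]
      refine integral_congr_ae (Eventually.of_forall fun t' => ?_)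
      dsimp only
      rw [← accept_mul_weight w ρ (hw0 t) t']
      ring
    -- second piece: `w t g t ∫ (1 − a) ρ = g t w t − ∫ s g t`
    have e2 : (∫ t', (1 - min 1 (w t' / w t)) * g t * ρ (t' - t)) * w t
        = g t * w t - ∫ t', metroFlow w ρ t t' * g t := by
      have hsplit2 : ∀ t', (1 - min 1 (w t' / w t)) * g t * ρ (t' - t)
          = g t * ρ (t' - t) - min 1 (w t' / w t) * g t * ρ (t' - t) := fun t' => by ring
      simp only [hsplit2]
      have hI3 : Integrable (fun t' => min 1 (w t' / w t) * g t * ρ (t' - t)) := by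
        refine Integrable.mono' (hρt.const_mul B)
          ((((measurable_const.min (hwm.div_const (w t))).mul measurable_const).mul
            (hρm.comp (measurable_id.sub_const t))).aestronglyMeasurable)
          (Eventually.of_forall fun t' => ?_)
        rw [Real.norm_eq_abs, abs_mul, abs_mul, abs_of_nonneg (ha_nn t t'), abs_of_nonneg (hρ0 _)]
        calc min 1 (w t' / w t) * |g t| * ρ (t' - t) ≤ 1 * B * ρ (t' - t) := by
              gcongr
              · exact hρ0 _
              · exact ha_le t t'
              · exact hgb t
          _ = B * ρ (t' - t) := by ring
      rw [integral_sub (hρt.const_mul (g t)) hI3, integral_const_mul,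
        integral_sub_right_eq_self (μ := (volume : Measure ℝ)) ρ t, hρ1, mul_one, sub_mul,
        ← integral_mul_const]
      congr 1
      refine integral_congr_ae (Eventually.of_forall fun t' => ?_)
      dsimp only
      rw [← accept_mul_weight w ρ (hw0 t) t']
      ring
    rw [e1, e2]
    ring
  simp only [hline]
  -- integrate over `t`: the two flow terms cancel by Fubini + symmetry
  have hI1t : Integrable (fun t => ∫ t', metroFlow w ρ t t' * g t') := hF1.integral_prod_left
  have hI2t : Integrable (fun t => ∫ t', metroFlow w ρ t t' * g t) := hF2.integral_prod_left
  have hgw : Integrable (fun t => g t * w t) := by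
    refine Integrable.mono' (hwi.const_mul B) (hgm.mul hwm).aestronglyMeasurable
      (Eventually.of_forall fun t => ?_)
    rw [Real.norm_eq_abs, abs_mul, abs_of_pos (hw0 t)]
    exact mul_le_mul_of_nonneg_right (hgb t) (hw0 t).le
  have hsum : Integrable (fun t => (∫ t', metroFlow w ρ t t' * g t') + g t * w t) := hI1t.add hgw
  rw [integral_sub hsum hI2t, integral_add hI1t hgw]
  have hswap : ∫ t, ∫ t', metroFlow w ρ t t' * g t' = ∫ t, ∫ t', metroFlow w ρ t t' * g t := by
    rw [integral_integral_swap hF1]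
    refine integral_congr_ae (Eventually.of_forall fun t' => ?_)
    refine integral_congr_ae (Eventually.of_forall fun t => ?_)
    dsimp only
    rw [metroFlow_symm w ρ hρs t t']
  rw [hswap]
  ring
end Line

/-! ## The lattice: the engine's single-site Metropolis hit for φ⁴ -/

section Lattice

variable {n : ℕ}
/-- The Metropolis acceptance probability of the move `φ_x → t'`:
`min(1, e^{−(S(φ|φ_x:=t') − S(φ))}) = min(1, w(φ|φ_x:=t')/w(φ))`, `w = e^{−S}`. -/
noncomputable def metroAccept (J : Fin (n + 1) → Fin (n + 1) → ℝ) (lam : ℝ) (x : Fin (n + 1))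
    (φ : Fin (n + 1) → ℝ) (t' : ℝ) : ℝ :=
  min 1 (gibbsWeight J lam (Function.update φ x t') / gibbsWeight J lam φ)

/-- The acceptance probability in the engine's form `min(1, e^{−ΔS})`. -/
theorem metroAccept_eq_exp (J : Fin (n + 1) → Fin (n + 1) → ℝ) (lam : ℝ) (x : Fin (n + 1))
    (φ : Fin (n + 1) → ℝ) (t' : ℝ) :
    metroAccept J lam x φ t'
      = min 1 (Real.exp (-(latticePhi4Action J lam (Function.update φ x t')
          - latticePhi4Action J lam φ))) := by
  unfold metroAccept gibbsWeight
  rw [← Real.exp_sub]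
  congr 2
  ring

/-- **The single-site random-walk Metropolis operator** of `latflow.core.phi4_2d` (and of row 2's
own kit): from `φ`, propose `φ_x → t' = φ_x + u` with `u ∼ ρ(u)du`, accept with probability
`min(1, e^{−ΔS})`, else keep `φ`; as an operator on observables. -/
noncomputable def metroSite (J : Fin (n + 1) → Fin (n + 1) → ℝ) (lam : ℝ) (ρ : ℝ → ℝ)
    (x : Fin (n + 1)) (f : (Fin (n + 1) → ℝ) → ℝ) (φ : Fin (n + 1) → ℝ) : ℝ :=
  ∫ t', (metroAccept J lam x φ t' * f (Function.update φ x t')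
    + (1 - metroAccept J lam x φ t') * f φ) * ρ (t' - φ x)

/-- The acceptance probability lies in `[0, 1]`. -/
theorem metroAccept_nonneg_le (J : Fin (n + 1) → Fin (n + 1) → ℝ) (lam : ℝ) (x : Fin (n + 1))
    (φ : Fin (n + 1) → ℝ) (t' : ℝ) :
    0 ≤ metroAccept J lam x φ t' ∧ metroAccept J lam x φ t' ≤ 1 :=
  ⟨le_min zero_le_one (div_nonneg (gibbsWeight_pos J lam _).le (gibbsWeight_pos J lam _).le),
    min_le_left _ _⟩

/-- The Metropolis image of a bounded observable is bounded by the same constant (`ρ ≥ 0` a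
probability density). -/
theorem abs_metroSite_le (J : Fin (n + 1) → Fin (n + 1) → ℝ) (lam : ℝ) {ρ : ℝ → ℝ}
    (hρ0 : ∀ u, 0 ≤ ρ u) (hρi : Integrable ρ) (hρ1 : ∫ u, ρ u = 1) (x : Fin (n + 1))
    {f : (Fin (n + 1) → ℝ) → ℝ} {B : ℝ} (hfb : ∀ φ, |f φ| ≤ B) (φ : Fin (n + 1) → ℝ) :
    |metroSite J lam ρ x f φ| ≤ B := by
  unfold metroSite
  have hρt : Integrable (fun t' => ρ (t' - φ x)) := hρi.comp_sub_right (φ x)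
  have hbound : ∀ t', ‖(metroAccept J lam x φ t' * f (Function.update φ x t')
      + (1 - metroAccept J lam x φ t') * f φ) * ρ (t' - φ x)‖ ≤ B * ρ (t' - φ x) := by
    intro t'
    obtain ⟨ha0, ha1⟩ := metroAccept_nonneg_le J lam x φ t'
    rw [Real.norm_eq_abs, abs_mul, abs_of_nonneg (hρ0 _)]
    refine mul_le_mul_of_nonneg_right ?_ (hρ0 _)
    calc |metroAccept J lam x φ t' * f (Function.update φ x t')
          + (1 - metroAccept J lam x φ t') * f φ|
        ≤ |metroAccept J lam x φ t' * f (Function.update φ x t')|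
            + |(1 - metroAccept J lam x φ t') * f φ| := abs_add_le _ _
      _ = metroAccept J lam x φ t' * |f (Function.update φ x t')|
            + (1 - metroAccept J lam x φ t') * |f φ| := by
          rw [abs_mul, abs_mul, abs_of_nonneg ha0,
            abs_of_nonneg (show (0 : ℝ) ≤ 1 - metroAccept J lam x φ t' by linarith)]
      _ ≤ metroAccept J lam x φ t' * B + (1 - metroAccept J lam x φ t') * B :=
          add_le_add (mul_le_mul_of_nonneg_left (hfb _) ha0)
            (mul_le_mul_of_nonneg_left (hfb _) (by linarith))
      _ = B := by ring
  have h := norm_integral_le_of_norm_le (hρt.const_mul B) (Eventually.of_forall hbound)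
  rw [integral_const_mul, integral_sub_right_eq_self (μ := (volume : Measure ℝ)) ρ (φ x), hρ1,
    mul_one, Real.norm_eq_abs] at h
  exact h

/-- Measurability of the Metropolis image of a measurable observable. -/
theorem measurable_metroSite (J : Fin (n + 1) → Fin (n + 1) → ℝ) (lam : ℝ) {ρ : ℝ → ℝ}
    (hρm : Measurable ρ) (x : Fin (n + 1)) {f : (Fin (n + 1) → ℝ) → ℝ} (hfm : Measurable f) :
    StronglyMeasurable (metroSite J lam ρ x f) := by
  have hw : Measurable (gibbsWeight J lam) := (continuous_gibbsWeight J lam).measurable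
  have hupd : Measurable fun p : (Fin (n + 1) → ℝ) × ℝ => Function.update p.1 x p.2 :=
    measurable_update'
  have ha : Measurable fun p : (Fin (n + 1) → ℝ) × ℝ => metroAccept J lam x p.1 p.2 := by
    unfold metroAccept
    exact measurable_const.min ((hw.comp hupd).div (hw.comp measurable_fst))
  have hF : Measurable fun p : (Fin (n + 1) → ℝ) × ℝ =>
      (metroAccept J lam x p.1 p.2 * f (Function.update p.1 x p.2)
        + (1 - metroAccept J lam x p.1 p.2) * f p.1) * ρ (p.2 - p.1 x) :=
    ((ha.mul (hfm.comp hupd)).add ((measurable_const.sub ha).mul (hfm.comp measurable_fst))).mul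
      (hρm.comp (measurable_snd.sub ((measurable_pi_apply x).comp measurable_fst)))
  exact hF.stronglyMeasurable.integral_prod_right'

/-- The weight along a coordinate line is integrable (coercive action, e.g. `λ > 0`): it is the
one-site quartic weight of `Scoring/SchwingerDysonPhi4.lean`. -/
theorem integrable_gibbsWeight_line {J : Fin (n + 1) → Fin (n + 1) → ℝ} {lam ε K : ℝ}
    (hε : 0 < ε) (hS : ∀ φ : Fin (n + 1) → ℝ, ε * ∑ w, φ w ^ 2 - K ≤ latticePhi4Action J lam φ)
    (ψ : Fin (n + 1) → ℝ) (x : Fin (n + 1)) (hψx : ψ x = 0) :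
    Integrable (fun t => gibbsWeight J lam (Function.update ψ x t)) := by
  have hupd0 : Function.update ψ x 0 = ψ := by
    have h := Function.update_eq_self x ψ
    rwa [hψx] at h
  have hK := sitePotential_coercive_of_coercive hε hS ψ x hψx
  have hI := integrable_pow_mul_phi4SiteWeight hε hK 0
  refine hI.congr (Eventually.of_forall fun t => ?_)
  simp only [pow_zero, one_mul, phi4SiteWeight, phi4SitePotential, gibbsWeight]
  rw [latticePhi4Action_update J lam ψ x t, hupd0]

/-- **THE SINGLE-SITE METROPOLIS HIT IS EXACT FOR LATTICE φ⁴ ON `ℝ^Λ`.**  Let the action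
`S = ΣφJφ + λΣφ⁴` be coercive (`εΣφ² − K ≤ S`: every `λ > 0` with ANY real `J`, incl. the
tachyonic AKS sets `m² = −4`, by `latticePhi4Action_coercive`; or `λ = 0` with `J + Jᵀ ≽ 2ε`).
Let the proposal increment have an even probability density `ρ`.  Then for every site `x` and
every bounded measurable observable `f`:  `∫ (M_x f) e^{−S} dφ = ∫ f e^{−S} dφ` — the Gibbs law
`e^{−S}dφ/Z` is invariant under the Metropolis hit, whatever the step law `ρ` (it only moves the
acceptance). -/
theorem metropolis_site_exact {J : Fin (n + 1) → Fin (n + 1) → ℝ} {lam ε K : ℝ} (hε : 0 < ε)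
    (hS : ∀ φ : Fin (n + 1) → ℝ, ε * ∑ w, φ w ^ 2 - K ≤ latticePhi4Action J lam φ)
    (x : Fin (n + 1)) {ρ : ℝ → ℝ} (hρ0 : ∀ u, 0 ≤ ρ u) (hρm : Measurable ρ) (hρi : Integrable ρ)
    (hρ1 : ∫ u, ρ u = 1) (hρs : ∀ u, ρ (-u) = ρ u) {f : (Fin (n + 1) → ℝ) → ℝ}
    (hfm : Measurable f) {B : ℝ} (hfb : ∀ φ, |f φ| ≤ B) :
    ∫ φ, metroSite J lam ρ x f φ * gibbsWeight J lam φ = ∫ φ, f φ * gibbsWeight J lam φ := by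
  have hw_int : Integrable (gibbsWeight J lam) := integrable_gibbsWeight_of_coercive hε hS
  have hG1 : Integrable (fun φ => f φ * gibbsWeight J lam φ) := by
    refine Integrable.mono' (hw_int.const_mul B) (hfm.aestronglyMeasurable.mul
      (continuous_gibbsWeight J lam).aestronglyMeasurable) (Eventually.of_forall fun φ => ?_)
    rw [Real.norm_eq_abs, abs_mul, abs_of_pos (gibbsWeight_pos J lam φ)]
    exact mul_le_mul_of_nonneg_right (hfb φ) (gibbsWeight_pos J lam φ).le
  have hG2 : Integrable (fun φ => metroSite J lam ρ x f φ * gibbsWeight J lam φ) := by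
    refine Integrable.mono' (hw_int.const_mul B)
      ((measurable_metroSite J lam hρm x hfm).aestronglyMeasurable.mul
        (continuous_gibbsWeight J lam).aestronglyMeasurable) (Eventually.of_forall fun φ => ?_)
    rw [Real.norm_eq_abs, abs_mul, abs_of_pos (gibbsWeight_pos J lam φ)]
    exact mul_le_mul_of_nonneg_right (abs_metroSite_le J lam hρ0 hρi hρ1 x hfb φ)
      (gibbsWeight_pos J lam φ).le
  rw [integral_eq_integral_insertNth x hG2, integral_eq_integral_insertNth x hG1]
  refine integral_congr_ae (Eventually.of_forall fun x' => ?_)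
  set ψ : Fin (n + 1) → ℝ := Fin.insertNth x (0 : ℝ) x' with hψ
  have hψx : ψ x = 0 := by simp [hψ]
  have hins : ∀ t : ℝ, (Fin.insertNth x t x' : Fin (n + 1) → ℝ) = Function.update ψ x t :=
    fun t => insertNth_eq_update x t x'
  simp only [hins]
  set w : ℝ → ℝ := fun t => gibbsWeight J lam (Function.update ψ x t) with hw
  have hw0 : ∀ t, 0 < w t := fun t => gibbsWeight_pos J lam _
  have hwm : Measurable w :=
    ((continuous_gibbsWeight J lam).measurable.comp
      (measurable_update' (a := x) |>.comp (measurable_const.prodMk measurable_id)))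
  have hwi : Integrable w := integrable_gibbsWeight_line hε hS ψ x hψx
  have hgm : Measurable fun t => f (Function.update ψ x t) :=
    hfm.comp (measurable_update' (a := x) |>.comp (measurable_const.prodMk measurable_id))
  have key := metropolis_line_invariant hw0 hwm hwi hρ0 hρm hρi hρ1 hρs hgm (fun t => hfb _)
  -- the lattice operator along the line IS the one-dimensional kernel
  have hK : ∀ t, metroSite J lam ρ x f (Function.update ψ x t)
      = ∫ t', (min 1 (w t' / w t) * f (Function.update ψ x t')
          + (1 - min 1 (w t' / w t)) * f (Function.update ψ x t)) * ρ (t' - t) := by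
    intro t
    unfold metroSite metroAccept
    simp only [Function.update_idem, Function.update_self, hw]
  simp only [hK]
  exact key

/-- **Normalised form**: `⟨M_x f⟩ = ⟨f⟩` in the Gibbs law. -/
theorem metropolis_site_exact_expect {J : Fin (n + 1) → Fin (n + 1) → ℝ} {lam ε K : ℝ}
    (hε : 0 < ε) (hS : ∀ φ : Fin (n + 1) → ℝ, ε * ∑ w, φ w ^ 2 - K ≤ latticePhi4Action J lam φ)
    (x : Fin (n + 1)) {ρ : ℝ → ℝ} (hρ0 : ∀ u, 0 ≤ ρ u) (hρm : Measurable ρ) (hρi : Integrable ρ)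
    (hρ1 : ∫ u, ρ u = 1) (hρs : ∀ u, ρ (-u) = ρ u) {f : (Fin (n + 1) → ℝ) → ℝ}
    (hfm : Measurable f) {B : ℝ} (hfb : ∀ φ, |f φ| ≤ B) :
    gibbsExpect J lam (metroSite J lam ρ x f) = gibbsExpect J lam f := by
  unfold gibbsExpect
  rw [metropolis_site_exact hε hS x hρ0 hρm hρi hρ1 hρs hfm hfb]

/-- **The φ⁴ instance at every `λ > 0`** (ANY real coupling matrix `J`, in particular the
engine's `−Δ_lat + m²` with `m² = −4` on the AKS 2019 sets): the Metropolis hit is exact. -/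
theorem metropolis_site_exact_phi4 {lam : ℝ} (hlam : 0 < lam) (J : Fin (n + 1) → Fin (n + 1) → ℝ)
    (x : Fin (n + 1)) {ρ : ℝ → ℝ} (hρ0 : ∀ u, 0 ≤ ρ u) (hρm : Measurable ρ) (hρi : Integrable ρ)
    (hρ1 : ∫ u, ρ u = 1) (hρs : ∀ u, ρ (-u) = ρ u) {f : (Fin (n + 1) → ℝ) → ℝ}
    (hfm : Measurable f) {B : ℝ} (hfb : ∀ φ, |f φ| ≤ B) :
    gibbsExpect J lam (metroSite J lam ρ x f) = gibbsExpect J lam f :=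
  metropolis_site_exact_expect one_pos (latticePhi4Action_coercive hlam J) x hρ0 hρm hρi hρ1 hρs
    hfm hfb
end Lattice

end Summit.Ventures.LatticeQCDFlow.Exactness
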